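import Summits.AtomisticToContinuum.Crystallization.Theorems.BraggSlacknessRigidityStrictCertificateNecessary
import Summits.AtomisticToContinuum.Crystallization.Theorems.BraggSlacknessRigidityStrictCertificateBragg
import Summits.AtomisticToContinuum.Crystallization.Theorems.ThreeConeCertificateExactCertificateTangency
import HarnessLib

/-!
# `StrictCertificate` (stmt-AtomisticToContinuum-13167) — negative lemma:
# the crux is refuted by EMPTINESS OF THE hcp FAR FIELD (`HcpFarFieldEmpty`, the typed W1(hcp) wall)

The crux `Theses.BraggSlacknessRigidity.StrictCertificate` asks for a strict exact three-cone certificate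
`V_LJ = g + U + f` at an hcp template `P = hcp(a,h)`.  This file records, kernel-checked, the complete list of
FAR-FIELD consequences the tree can presently extract from a witness — everything about the template
parameters `(a,h)`, the range `ρ` and the Bochner kernel `f` alone (the finite-range core `g` and the slack
`U` eliminated) — and packages their conjunction, negated over all `(a, h, ρ, f)`, as the hypothesis
`HcpFarFieldEmpty`:

  `strictCertificate_false_of_hcpFarFieldEmpty : HcpFarFieldEmpty → ¬ StrictCertificate`.

The seventeen clauses (at `P := hcp(a,h)`, `F := f∘‖·‖ : ℝ³ → ℂ`): template minimality among periodic
configurations (`Slackness.witness_eq`) and the virial / zero-pressure identities `e₆(P) = e₁₂(P)`,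
`e_LJ(P) = −e₆(P)/12` (`Dilation.stub_zeroPressure`); `ρ > 0`; the crux's Fourier package verbatim
(conjuncts 10–14: `F`, `𝓕F` continuous/integrable, `𝓕F` real `≥ 0`, `𝓕F ≠ 0` off `{0} ∪` Bragg spheres); the
forced zero `𝓕F(0) = 0` (`…Necessary.fourier_zero_eq_zero`); BRAGG-PEAK VANISHING `S_P(k)·𝓕F(k) = 0` on the dual
lattice (`…Bragg.structureFactor_mul_fourier_eq_zero`); positive type of `f`; one-sided contact `f ≤ V_LJ` on
`[ρ,∞)` with contact set EXACTLY `D_P ∩ [ρ,∞)` (`…Necessary.f_eq_lennardJones_iff`); quadratic squeeze and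
TANGENCY `f′ = V_LJ′` at every template distance `> ρ` (`Contact.stub_tangency`); neutrality
`f 0 + 2e_f(P) = 0` and INVISIBILITY `Σ_{y∈P} f(|w − y|) = 0 ∀ w` (`Field.invisible_of_isSplit`); the charge
bounds `0 < f 0 ≤ −2e_LJ(P)`; and `∫ 𝓕F = f 0`.

`HcpFarFieldEmpty` is the hcp instance of the sibling census's `TailEmptyAll` (Cruxes/ExactCertificate/
STRATEGY-CENSUS.md §5), enriched with the strict package and the template clauses; it is free of item 0627 in
the sense that PROVING it needs no minimality input (minimality appears only inside the negated conjunction,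
as extra information), and it is EXPECTED TRUE there (one-sided radial interpolation with `𝓕F ≥ 0` vanishing
on the non-extinct Bragg spheres is supercritical in `d = 3`), but no catalogued non-interpolation theorem
proves it today — hence a negative lemma modulo `H`, not a refutation.  The converse bookkeeping
`not_hcpFarFieldEmpty_of_strictCertificate` is recorded too.  No cited facts; no new structures beyond `H`.
-/

set_option linter.dupNamespace false

noncomputable section

namespace Summit.AtomisticToContinuum.Crystallization.Theorems.StrictCertificate.Negative

open Literature.MathematicalPhysics.StatisticalMechanics
open Summit.AtomisticToContinuum.Crystallization.Theses.BraggSlacknessRigidity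
open Summit.AtomisticToContinuum.Crystallization.Theorems.ExactCertificateNegative (IsSplit)
open Summit.AtomisticToContinuum.Crystallization.Theorems.ChargedEnergyGapNegative (E3 eStar eStar_le)
open Summit.AtomisticToContinuum.Crystallization.Theorems.ThreeConeCertificateExactCertificate.Slackness
  (witness_eq f_zero_add_two_mul_energyPerParticle_f)
open Summit.AtomisticToContinuum.Crystallization.Theorems.ThreeConeCertificateExactCertificate.Field
  (invisible_of_isSplit)
open Summit.AtomisticToContinuum.Crystallization.Theorems.ThreeConeCertificateExactCertificate.Contact
  (stub_tangency le_energyPerParticle_dilate)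
open Summit.AtomisticToContinuum.Crystallization.Theorems.ThreeConeCertificateExactCertificate.Dilation
  (stub_zeroPressure)
open Summit.AtomisticToContinuum.Crystallization.Theorems.BraggSlacknessRigidityStrictCertificate
  (fourier_zero_eq_zero f_eq_lennardJones_iff structureFactor_mul_fourier_eq_zero integral_fourier_eq_f_zero)
open MeasureTheory
open scoped BigOperators FourierTransform RealInnerProductSpace

/-- **Hypothesis `HcpFarFieldEmpty` (the `H` of the negative lemma below; the typed far-field wall W1 at hcp).**
For NO template parameters `a, h ≠ 0`, range `ρ` and radial kernel `f : ℝ → ℝ` do all of the following hold at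
`P := hcpPeriodicConfiguration a h`, `F := f∘‖·‖ : ℝ³ → ℂ`: (1) `P` minimises the Lennard-Jones energy per
particle among periodic configurations; (2) virial identities `e₆(P) = e₁₂(P)`, `e_LJ(P) = −e₆(P)/12`;
(3) `ρ > 0`; (4)–(8) `F` continuous and integrable, `𝓕F` integrable, real and `≥ 0`, and `≠ 0` at `ξ ≠ 0` off the
Bragg spheres of `P.lattice`; (9) `𝓕F(0) = 0`; (10) `S_P(k)·𝓕F(k) = 0` for every dual-lattice vector `k`
(`S_P(k) = Σ_{x∈motif} e^{−2πi⟨x,k⟩}`); (11) `f` radially of positive type; (12) `f ≤ V_LJ` on `[ρ,∞)`;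
(13) contact set there exactly the distance set of `P`; (14) quadratic squeeze and tangency `f′(r) = V_LJ′(r)` at
template distances `r > ρ`; (15) neutrality `f 0 + 2e_f(P) = 0`; (16) invisibility of the crystal,
`Σ_{y∈P} f(|w−y|) = 0` for all `w`; (17) `0 < f 0 ≤ −2e_LJ(P)`; (18) `∫𝓕F = f 0`.
Intended reading: the one-sided radial Fourier interpolation problem at hcp has no solution (sibling census
`TailEmptyAll`, hcp instance, expected TRUE: supercritical density of Bragg radii in `d = 3`); proving it needs
no minimality input.  If `H` is REFUTED (a far-field kernel exists at some minimising hcp), the hold this lemma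
places on stmt-13167 is lifted and the remaining content of the crux is the charged core bound. [folklore] -/
@[conjecture] def HcpFarFieldEmpty : Prop :=
  ∀ (a h : ℝ) (ha : a ≠ 0) (hh : h ≠ 0) (ρ : ℝ) (f : ℝ → ℝ), ¬ ((∀ Q : Literature.MathematicalPhysics.StatisticalMechanics.PeriodicConfiguration 3, (Literature.MathematicalPhysics.StatisticalMechanics.hcpPeriodicConfiguration ha hh).energyPerParticle Literature.MathematicalPhysics.StatisticalMechanics.lennardJones ≤ Q.energyPerParticle Literature.MathematicalPhysics.StatisticalMechanics.lennardJones) ∧ ((Literature.MathematicalPhysics.StatisticalMechanics.hcpPeriodicConfiguration ha hh).energyPerParticle (fun r => (r⁻¹) ^ 6) = (Literature.MathematicalPhysics.StatisticalMechanics.hcpPeriodicConfiguration ha hh).energyPerParticle (fun r => (r⁻¹) ^ 12) ∧ (Literature.MathematicalPhysics.StatisticalMechanics.hcpPeriodicConfiguration ha hh).energyPerParticle Literature.MathematicalPhysics.StatisticalMechanics.lennardJones = -(1 / 12) * (Literature.MathematicalPhysics.StatisticalMechanics.hcpPeriodicConfiguration ha hh).energyPerParticle (fun r => (r⁻¹)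 ^ 6)) ∧ 0 < ρ ∧ Continuous (fun v : EuclideanSpace ℝ (Fin 3) => (f ‖v‖ : ℂ)) ∧ MeasureTheory.Integrable (fun v : EuclideanSpace ℝ (Fin 3) => (f ‖v‖ : ℂ)) ∧ MeasureTheory.Integrable (FourierTransform.fourier (fun v : EuclideanSpace ℝ (Fin 3) => (f ‖v‖ : ℂ))) ∧ (∀ ξ : EuclideanSpace ℝ (Fin 3), (FourierTransform.fourier (fun v : EuclideanSpace ℝ (Fin 3) => (f ‖v‖ : ℂ)) ξ).im = 0 ∧ 0 ≤ (FourierTransform.fourier (fun v : EuclideanSpace ℝ (Fin 3) => (f ‖v‖ : ℂ)) ξ).re) ∧ (∀ ξ : EuclideanSpace ℝ (Fin 3), ξ ≠ 0 → (∀ k : EuclideanSpace ℝ (Fin 3), (∀ g ∈ (Literature.MathematicalPhysics.StatisticalMechanics.hcpPeriodicConfiguration ha hh).lattice, ∃ n : ℤ, inner ℝ k g = (n : ℝ)) → ‖ξ‖ ≠ ‖k‖) → FourierTransform.fourier (fun v : EuclideanSpace ℝ (Fin 3) => (f ‖v‖ : ℂ)) ξ ≠ 0) ∧ FourierTransform.fourier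 (fun v : EuclideanSpace ℝ (Fin 3) => (f ‖v‖ : ℂ)) 0 = 0 ∧ (∀ k : EuclideanSpace ℝ (Fin 3), (∀ g ∈ (Literature.MathematicalPhysics.StatisticalMechanics.hcpPeriodicConfiguration ha hh).lattice, ∃ n : ℤ, inner ℝ k g = (n : ℝ)) → (∑ x ∈ (Literature.MathematicalPhysics.StatisticalMechanics.hcpPeriodicConfiguration ha hh).motif, Complex.exp (↑(-2 * Real.pi * inner ℝ x k) * Complex.I)) * FourierTransform.fourier (fun v : EuclideanSpace ℝ (Fin 3) => (f ‖v‖ : ℂ)) k = 0) ∧ (∀ (n : ℕ) (y : Fin n → EuclideanSpace ℝ (Fin 3)) (w : Fin n → ℝ), 0 ≤ ∑ i, ∑ j, w i * w j * f (dist (y i) (y j))) ∧ (∀ r : ℝ, ρ ≤ r → f r ≤ Literature.MathematicalPhysics.StatisticalMechanics.lennardJones r) ∧ (∀ r : ℝ, ρ ≤ r → (f r = Literature.MathematicalPhysics.StatisticalMechanics.lennardJones r ↔ ∃ p ∈ (Literature.MathematicalPhysics.StatisticalMechanics.hcpPeriodicConfiguration ha hh).points, ∃ q ∈ (Literature.MathematicalPhysics.StatisticalMechanics.hcpPeriodicConfiguration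 ha hh).points, r = dist p q)) ∧ (∀ p ∈ (Literature.MathematicalPhysics.StatisticalMechanics.hcpPeriodicConfiguration ha hh).points, ∀ q ∈ (Literature.MathematicalPhysics.StatisticalMechanics.hcpPeriodicConfiguration ha hh).points, p ≠ q → ρ < dist p q → (∃ C δ : ℝ, 0 < δ ∧ ∀ s : ℝ, |s - dist p q| < δ → 0 ≤ Literature.MathematicalPhysics.StatisticalMechanics.lennardJones s - f s ∧ Literature.MathematicalPhysics.StatisticalMechanics.lennardJones s - f s ≤ C * (s - dist p q) ^ 2) ∧ HasDerivAt f (deriv Literature.MathematicalPhysics.StatisticalMechanics.lennardJones (dist p q)) (dist p q)) ∧ f 0 + 2 * (Literature.MathematicalPhysics.StatisticalMechanics.hcpPeriodicConfiguration ha hh).energyPerParticle f = 0 ∧ (∀ w : EuclideanSpace ℝ (Fin 3), HasSum (fun y : (Literature.MathematicalPhysics.StatisticalMechanics.hcpPeriodicConfiguration ha hh).points => f (dist w (y : EuclideanSpace ℝ (Fin 3)))) 0) ∧ (0 < f 0 ∧ f 0 ≤ -2 * (Literature.MathematicalPhysics.StatisticalMechanics.hcpPeriodicConfiguration ha hh).energyPerParticle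 Literature.MathematicalPhysics.StatisticalMechanics.lennardJones) ∧ ∫ ξ : EuclideanSpace ℝ (Fin 3), FourierTransform.fourier (fun v : EuclideanSpace ℝ (Fin 3) => (f ‖v‖ : ℂ)) ξ = (f 0 : ℂ))

/-- **Negative lemma: `HcpFarFieldEmpty → ¬ StrictCertificate`.**  Every witness `⟨hcp(a,h), ρ, c, g, U, f⟩` of
the crux yields `(a, h, max ρ 1, f)` satisfying all eighteen clauses (sources in the module docstring).
[folklore] -/
theorem strictCertificate_false_of_hcpFarFieldEmpty : HcpFarFieldEmpty → ¬ StrictCertificate := by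
  intro hH hS
  obtain ⟨P, ρ, c, g, U, f, ⟨a, h, ha, hh, rfl⟩, h1, h2, h3, h4, h5, h6, -, h9, hFc, hFi, hFF, hre,
    hstrictF⟩ := hS
  have hs : IsSplit ρ c g U f := ⟨h1, h2, h3, h4, h5⟩
  have hv : c + f 0 / 2 ≤ -((hcpPeriodicConfiguration ha hh).energyPerParticle lennardJones) := h6.le
  have hρ' : (0 : ℝ) < max ρ 1 := lt_max_of_lt_right one_pos
  refine hH a h ha hh (max ρ 1) f ⟨?_, ?_, hρ', hFc, hFi, hFF, hre, hstrictF, fourier_zero_eq_zero hs hv hFi,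
    fun k hk => structureFactor_mul_fourier_eq_zero hs hv hFi hk, h4, ?_, ?_, ?_,
    f_zero_add_two_mul_energyPerParticle_f hs hv, fun w => invisible_of_isSplit hs hv w,
    ⟨hs.f_zero_pos, by linarith [hs.c_nonneg]⟩, integral_fourier_eq_f_zero f hFc hFi hFF⟩
  · -- (1) template minimality, by complementary slackness
    intro Q
    rw [(witness_eq hs hv).1]
    exact eStar_le Q
  · -- (2) virial / zero pressure of the witness template
    obtain ⟨hvir, hLJ, -⟩ :=
      stub_zeroPressure (hcpPeriodicConfiguration ha hh) fun t ht => le_energyPerParticle_dilate hs hv ht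
    exact ⟨hvir, hLJ⟩
  · -- (12) one-sided contact beyond the range
    intro r hr
    have hr0 : 0 < r := lt_of_lt_of_le hρ' hr
    have hV := h1 r hr0
    rw [h3 r ((le_max_left _ _).trans hr)] at hV
    linarith [h2 r hr0]
  · -- (13) exact contact set
    intro r hr
    exact f_eq_lennardJones_iff hs hv h9 ((le_max_left _ _).trans hr) (lt_of_lt_of_le hρ' hr)
  · -- (14) quadratic squeeze and tangency at template distances beyond the range
    intro p hp q hq hpq hρq
    exact stub_tangency _ ρ c g U f hs hv p hp q hq hpq (lt_of_le_of_lt (le_max_left _ _) hρq)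

/-- Converse bookkeeping: a witness of the crux refutes `HcpFarFieldEmpty`. [folklore] -/
theorem not_hcpFarFieldEmpty_of_strictCertificate : StrictCertificate → ¬ HcpFarFieldEmpty :=
  fun hS hH => strictCertificate_false_of_hcpFarFieldEmpty hH hS

end Summit.AtomisticToContinuum.Crystallization.Theorems.StrictCertificate.Negative

end
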